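import Summits.QuantumFields.BalabanUV.Beta.EriceRemainderEnclosureHistoryRenewalWitnessRate
import Summits.QuantumFields.BalabanUV.Beta.EriceRemainderEnclosureHistoryFadingContinuum

/-!
# EriceRemainderEnclosureHistoryFadingWitness — (E36c) THE RATIO CANNOT BE UNIFORM IN THE FADING CONSTANT: every digital witness of
# (E35) HAS a fading modulus of its own (finitely many live ages), so for every `κ < 1` and every `C′` some member of the class
# «`FadingMemory` with SOME constant + rows ≤ M + sign + floor» beats `C′·κ^j`; with (E36b) BY NAME the DICHOTOMY of the rate row:
# for each fading constant `C` ONE ratio `κ(C) < 1` serves the whole class (geometric shape, node U2's constant), and NO ratio serves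
# all fading constants at once

Cell `pub-balaban`, β-function sub-cell, BINDER row D4 «RemainderConst leaves for Bałaban's split» (`HOME/BINDER-OWNERS.md`; owner
lineage `b2b-balaban-beta-an4`; this file by co-owner #2 lineage `b2b-balaban-beta-d4-p2`, generation 38), β-FLOW TEAM duty (1),
FREEZE (0) honoured (def-free; no new leaf, no new hypothesis shape).  The sharpness half of station (E36), over (E35a)∕(E35b)∕(E35c)
`EriceRemainderEnclosureHistoryRenewalWitness{,Runs,Rate}` (the digital design: `rgEqH_A` ∕ `rgEqH_B` ∕ `runs_box_pin` ∕ `scaleShiftRate` ∕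
`histLipschitz_rows` ∕ `floors` ∕ `eps_le_disc` ∕ `staged_cost_le` ∕ `exists_stages` BY NAME) and (E36b)
`EriceRemainderEnclosureHistoryFadingContinuum.geometric_uniform_fading_sign`.

HONEST FRAMING (page 1, verbatim and binding).  *"Discharging BetaPertH makes Bałaban's UV stability UNCONDITIONAL — a real
constructive-QFT result; it is NOT the continuum limit and NOT the Clay problem."*  THIS FILE DISCHARGES NOTHING OF THE KIND.  It is
[folklore] real analysis — an explicit WITNESS family about the cell's own NOT-IN-PRINT binders (node U2's `ScaleShiftRate`,
`HistLipschitz`, `FadingMemory`, GAPS G-t4-U2-1∕-2; the floor shape of (0.31)); nothing of [I] (1.22) is asserted; nothing of Bałaban's is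
quoted newly (loci verbatim in the headers of `FlowStep` ∕ `T4CouplingMatching`).  Row D4 class UNCHANGED (critical-path width 0; instance
0∕1; D4 DISCHARGE NO DATE).  HONEST DEPENDENCY: continuum YM on T⁴ ⇐ BetaPertH ∧ nine spine estimates (0/9 proved); BetaPertH ⇐ (D1) ∧
(D4) ∧ CAP+tail; G-an2-4 gates asym, D1 and NE2/3/4.

THE POINT (census sense (α)).  (E36a)∕(E36b): for EVERY fading constant `C` the row smallness `4·M·U < 1` gives ONE ratio `κ(C) < 1` with
`disc_j ≤ (2c∕(1−θ))·κ(C)^j` over the whole class; the constant is paid in the ratio (`log(1∕κ) ≍ log(1∕θ)·log(1∕(4MU))∕log(C∕M)`).  Here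
the converse bookkeeping: the digital witness of (E35) with `s + 1` stages reads its history at the finitely many ages `a_0 < … < a_s`
only, so its modulus `Λ k (k − a_t) = ε_t·L_t` IS fading, with constant `Σ_t ε_t·L_t∕θ^{a_t}` (§1 `fadingMemory_of_stages`; for the staged
pattern `≍ (1 + Ytop)³·θ^{−a_{s−1}}`, `a_{s−1} = 2s² − s + 1` — astronomically large, never small).  Hence (§2 `not_geometric_fading`) for
every `κ < 1` and `C′` a member of the class WITH a fading modulus beats `C′·κ^j` (at `j = k_s ≥ s³`, `disc = cθ^{2s²+s}∕(s+1)`): the ratio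
of (E36b) can NOT be chosen uniformly in the fading constant, and (§3 `fading_dichotomy`, both halves BY NAME) the rate row of the
history channel closes as a DICHOTOMY — geometric shape ⟺ a bound on the fading constant (more generally: on an exponential age-moment)
over the class; the smallness node U2 places on the fading constant is not needed for the shape, its FINITENESS is.  Quantitatively
(by inspection, not kernel-typed): the `s`-stage witness has `log C ≍ 2s²·log(1∕θ)` and forces `log(1∕κ(C)) ≲ 2·log(1∕θ)∕s ≍
(log(1∕θ))^{3∕2}∕√(log C)`, against (E36b)'s `log(1∕κ(C)) ≳ log(1∕θ)·log(1∕(4MU))∕log(C∕M)`; the two-parameter pattern of (E35d) narrows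
the window to a `log log C` factor.  NOT B12 Thm 2, NOT BetaPertH, NOT continuum, NOT Clay.

WHAT IS PROVED ([folklore]; 0 `def`, 0 sorry; nothing of [I] asserted).
 §1 `fadingMemory_of_stages` (the explicit modulus of (E35b) `histLipschitz_rows` satisfies `FadingMemory (Σ_t ε_t L_t∕θ^{a_t}) θ`).
 §2 `witness_core_fading` ((E35b) `witness_core` with the fading conjunct and its explicit constant), **`not_geometric_fading`** ((E35c)
    `not_geometric` inside the sub-class «`FadingMemory` with some constant»), **`staged_witness_fading`** (the `s`-stage witness has fading
    constant `≤ C_s = (1 + 1∕γ² + (b+c)(s³+2s²+2s+2))³(c∕b+s)∕θ^{2s²+s+1}` and `disc ≥ cθ^{2s²+s}∕(s+1)` at `j = s³+2s²+2s`),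
    **`ratio_lower_bound`** (any `(D, κ)` serving the class with fading constant `C_s` has `cθ^{2s²+s}∕(s+1) ≤ D·κ^{s³+2s²+2s}`).
 §3 **`fading_dichotomy`** ((E36b) `geometric_uniform_fading_sign` + §2, by name).
-/

noncomputable section
open Finset

namespace Summit.QuantumFields.BalabanUV.Beta.EriceRemainderEnclosureHistoryFadingWitness

open Literature.MathematicalPhysics.QuantumFieldTheory.Balaban1983to89
open Literature.MathematicalPhysics.QuantumFieldTheory.Balaban1983to89.FlowStep
open Literature.MathematicalPhysics.QuantumFieldTheory.Balaban1983to89.T4CouplingMatching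
open Summit.QuantumFields.BalabanUV.Beta.EriceRemainderEnclosureHistoryRenewalWitness
open Summit.QuantumFields.BalabanUV.Beta.EriceRemainderEnclosureHistoryRenewalWitnessRuns
  (rgEqH_A rgEqH_B runs_box_pin scaleShiftRate histLipschitz_rows floors eps_le_disc)
open Summit.QuantumFields.BalabanUV.Beta.EriceRemainderEnclosureHistoryRenewalWitnessRate (staged_cost_le exists_stages)
open Summit.QuantumFields.BalabanUV.Beta.EriceRemainderEnclosureHistoryFadingContinuum (geometric_uniform_fading_sign)

/-! ## §1 The digital modulus is fading -/

/-- **THE DIGITAL MODULUS IS FADING.**  The explicit modulus of (E35b) `histLipschitz_rows` —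
`Λ k i = Σ_{t≤s} [i = k − a_t]·[a_t ≤ k]·ε_t·L_t` (live ages `a_t` only) — satisfies `FadingMemory (Σ_{t≤s} ε_t·L_t∕θ^{a_t}) θ Λ` for every
`θ > 0` (`ε, L ≥ 0`): at a live age `a_t` the cap `(ε_t L_t∕θ^{a_t})·θ^{a_t} = ε_t L_t` is met with equality, elsewhere `Λ = 0`.  Each
digital witness thus HAS a fading modulus; its constant is as large as `θ^{−a_t}` at the oldest live age. [folklore] -/
theorem fadingMemory_of_stages {θ : ℝ} {s : ℕ} {a : ℕ → ℕ} {ε L : ℕ → ℝ} {Λ : ℕ → ℕ → ℝ}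
    (hθ0 : 0 < θ) (hε0 : ∀ t, 0 ≤ ε t) (hL0 : ∀ t, 0 ≤ L t)
    (hΛ : ∀ kk i, Λ kk i = ∑ t ∈ range (s + 1), if i = kk - a t then (if a t ≤ kk then ε t * L t else 0) else 0) :
    FadingMemory (∑ t ∈ range (s + 1), ε t * L t / θ ^ a t) θ Λ := by
  intro kk i _
  refine ⟨?_, ?_⟩
  · rw [hΛ]
    exact sum_nonneg fun t _ => by
      split_ifs <;> first | exact mul_nonneg (hε0 t) (hL0 t) | exact le_rfl
  · rw [hΛ, sum_mul]
    refine sum_le_sum fun t _ => ?_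
    have hnn : 0 ≤ ε t * L t / θ ^ a t * θ ^ (kk - i) := by
      have := hε0 t; have := hL0 t; positivity
    split_ifs with h1 h2
    · have hki : kk - i = a t := by omega
      rw [hki, div_mul_cancel₀ _ (pow_ne_zero _ hθ0.ne')]
    · exact hnn
    · exact hnn

/-! ## §2 The digital witnesses inside the sub-class with a fading modulus -/

/-- **THE CORE OF THE WITNESS, WITH ITS FADING MODULUS** ((E35b) `witness_core` + §1).  For all `c θ γ b > 0` (`θ ≤ 1`) and every firing
pattern (`a_0 = k_0 + 1`, `k_{t+1} = k_t + a_{t+1}`, `ε_t = cθ^{a_t−1}∕(s+1) ≤ b`) there are `β`, `Λ`, `gA`, `gB` with the WHOLE binder list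
of (E33g) `disc_le_sqrt_uniform_sign` (two pinned runs of (0.20) in ]0,γ] of `k_s + 1` and `k_s + 2` steps, `ScaleShiftRate c θ γ β`,
`HistLipschitz Λ γ β`, `Λ ≥ 0`, rows `≤ (1 + 1∕γ² + (b+c)(k_s+2))³·(ε_0∕b + Σ_{t<s} θ^{a_{t+1}−1}∕θ^{a_t−1})`, `BetaLowerH 0 γ β`,
`EventualLowerH b γ 0 β`), AND `FadingMemory C_Λ θ Λ` with the EXPLICIT constant
`C_Λ = (1 + 1∕γ² + (b+c)(k_s+2))³·(cθ^{a_0−1}∕((s+1)·b·θ^{a_0}) + Σ_{t<s} θ^{a_{t+1}−1}∕(θ^{a_t−1}·θ^{a_{t+1}}))` (`= (1+Ytop)³·(c∕((s+1)bθ) +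
Σ_{t<s} θ^{−a_t})` when all ages are `≥ 1`), and `cθ^{a_s−1}∕(s+1) ≤ disc gA gB (k_s)`.  The construction is (E35a)∕(E35b)'s verbatim (BY
NAME); only the fading conjunct and its constant are new. [folklore] -/
theorem witness_core_fading {c θ γ b : ℝ} (hc : 0 < c) (hθ0 : 0 < θ) (hθ1 : θ ≤ 1) (hγ : 0 < γ) (hb : 0 < b)
    {s : ℕ} {a k : ℕ → ℕ} (ha0 : a 0 = k 0 + 1) (hak : ∀ t, t < s → k (t + 1) = k t + a (t + 1))
    (hεb : ∀ t, t ≤ s → c * θ ^ (a t - 1) / (s + 1) ≤ b) :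
    ∃ (β : HBeta) (Λ : ℕ → ℕ → ℝ) (gA gB : ℕ → ℝ),
      RGEqH (k s + 1) β gA ∧ RGEqH (k s + 1 + 1) β gB ∧
      (∀ i, i ≤ k s + 1 → 0 < gA i ∧ gA i ≤ γ) ∧ (∀ i, i ≤ k s + 1 + 1 → 0 < gB i ∧ gB i ≤ γ) ∧
      gA (k s + 1) = gB (k s + 1 + 1) ∧
      ScaleShiftRate c θ γ β ∧ HistLipschitz Λ γ β ∧ (∀ kk i, i ≤ kk → 0 ≤ Λ kk i) ∧
      (∀ kk, ∑ i ∈ range (kk + 1), Λ kk i ≤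
        (1 + (1 / γ ^ 2 + (b + c) * (k s + 2))) ^ 3 *
          (c * θ ^ (a 0 - 1) / (s + 1) / b + ∑ t ∈ range s, θ ^ (a (t + 1) - 1) / θ ^ (a t - 1))) ∧
      FadingMemory ((1 + (1 / γ ^ 2 + (b + c) * (k s + 2))) ^ 3 *
          (c * θ ^ (a 0 - 1) / (s + 1) / b / θ ^ a 0 +
            ∑ t ∈ range s, θ ^ (a (t + 1) - 1) / θ ^ (a t - 1) / θ ^ a (t + 1))) θ Λ ∧
      BetaLowerH 0 γ β ∧ EventualLowerH b γ 0 β ∧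
      c * θ ^ (a s - 1) / (s + 1) ≤ disc gA gB (k s) := by
  -- pattern consequences
  have hmono : ∀ n t, t + n ≤ s → k t ≤ k (t + n) := by
    intro n
    induction n with
    | zero => intro t _; simp
    | succ n ih =>
      intro t h
      have h1 := ih t (by omega)
      have h2 := hak (t + n) (by omega)
      rw [← add_assoc, h2]; omega
  have hks : ∀ t, t ≤ s → k t ≤ k s := fun t ht => by
    have := hmono (s - t) t (by omega); rwa [Nat.add_sub_cancel' ht] at this
  have hka : ∀ t, t ≤ s → a t ≤ k t + 1 := by
    intro t ht
    cases t with
    | zero => omega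
    | succ t => have := hak t (by omega); omega
  -- the data, by defining equations (verbatim (E35b))
  obtain ⟨ε, hε⟩ : ∃ ε : ℕ → ℝ, ∀ t, ε t = c * θ ^ (a t - 1) / (s + 1) := ⟨_, fun _ => rfl⟩
  obtain ⟨S, hS⟩ : ∃ S : ℝ, S = ∑ t ∈ range (s + 1), ε t := ⟨_, rfl⟩
  obtain ⟨B₀, hB⟩ : ∃ B₀ : ℝ, B₀ = b + S := ⟨_, rfl⟩
  obtain ⟨xs, hx⟩ : ∃ xs : ℝ, xs = 1 / γ ^ 2 := ⟨_, rfl⟩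
  obtain ⟨Y, hY⟩ : ∃ Y : ℕ → ℝ, ∀ m : ℕ, Y m = xs + B₀ * m := ⟨_, fun _ => rfl⟩
  obtain ⟨W, hW⟩ : ∃ W : ℕ → ℝ, ∀ i, W i = ∑ t ∈ range (s + 1), if i ≤ k t + 1 then ε t else 0 := ⟨_, fun _ => rfl⟩
  obtain ⟨Ytop, hT⟩ : ∃ Ytop : ℝ, Ytop = xs + (b + c) * (k s + 2) := ⟨_, rfl⟩
  obtain ⟨η, hη0, hηs⟩ : ∃ η : ℕ → ℝ, η 0 = b ∧ ∀ t, η (t + 1) = ε t :=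
    ⟨fun t => Nat.casesOn t b (fun t' => ε t'), rfl, fun _ => rfl⟩
  obtain ⟨L, hL⟩ : ∃ L : ℕ → ℝ, ∀ t, L t = (1 + Ytop) ^ 3 / η t := ⟨_, fun _ => rfl⟩
  obtain ⟨gA, hgA⟩ : ∃ gA : ℕ → ℝ, ∀ i, gA i = 1 / Real.sqrt (Y (k s + 1 - i)) := ⟨_, fun _ => rfl⟩
  obtain ⟨gB, hgB⟩ : ∃ gB : ℕ → ℝ, ∀ i, gB i = 1 / Real.sqrt (Y (k s + 1 + 1 - i) - W i) := ⟨_, fun _ => rfl⟩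
  obtain ⟨β, hβ⟩ : ∃ β : HBeta, ∀ kk v, β kk v = B₀ - ∑ t ∈ range (s + 1),
      if a t ≤ kk then ε t * max 0 (1 - L t * |v ⟨kk - a t, Nat.sub_lt_succ kk (a t)⟩ - gB (k t + 1 - a t)|) else 0 :=
    ⟨fun kk v => _, fun _ _ => rfl⟩
  obtain ⟨Λ, hΛ⟩ : ∃ Λ : ℕ → ℕ → ℝ, ∀ kk i, Λ kk i = ∑ t ∈ range (s + 1),
      if i = kk - a t then (if a t ≤ kk then ε t * L t else 0) else 0 := ⟨_, fun _ _ => rfl⟩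
  have hεb' : ∀ t, t ≤ s → ε t ≤ b := fun t ht => (hε t).symm ▸ hεb t ht
  obtain ⟨hxs, -, -, -, -, -, -⟩ := grid_bounds hc hθ0 hθ1 hγ hb hε hS hB hx hY hT
  have hYtop : 0 ≤ Ytop := by rw [hT]; positivity
  obtain ⟨hAbox, hBbox, hpin⟩ := runs_box_pin hc hθ0 hθ1 hγ hb hε hS hB hx hY rfl hW hT hgA hgB hks
  obtain ⟨hHL, hΛ0, hrows⟩ := histLipschitz_rows (γ := γ) hc hθ0 hb hε hη0 hηs hL hYtop hβ hΛ
  obtain ⟨hsign, hfloor⟩ := floors (γ := γ) hc hθ0 hb hε hS hB hη0 hηs hL hYtop hβ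
  -- NEW: the modulus is fading (§1)
  have hp := eps_pos hc hθ0 hε
  have hLpos : ∀ t, 0 ≤ L t := fun t => by
    rw [hL]; refine div_nonneg (by positivity) ?_
    cases t with
    | zero => rw [hη0]; exact hb.le
    | succ t => rw [hηs]; exact (hp t).le
  have hfade : FadingMemory (∑ t ∈ range (s + 1), ε t * L t / θ ^ a t) θ Λ :=
    fadingMemory_of_stages hθ0 (fun t => (hp t).le) hLpos hΛ
  -- the fading constant, explicitly
  have hfcost : ∑ t ∈ range (s + 1), ε t * L t / θ ^ a t = (1 + (1 / γ ^ 2 + (b + c) * (k s + 2))) ^ 3 *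
      (c * θ ^ (a 0 - 1) / (s + 1) / b / θ ^ a 0 +
        ∑ t ∈ range s, θ ^ (a (t + 1) - 1) / θ ^ (a t - 1) / θ ^ a (t + 1)) := by
    rw [sum_range_succ', hL, hη0, mul_add, mul_sum, add_comm]
    congr 1
    · rw [hε, hT, hx]; ring
    · refine sum_congr rfl fun t _ => ?_
      rw [hL, hηs, hT, hx, hε, hε]
      have h1 : (0 : ℝ) < θ ^ (a t - 1) := by positivity
      have h2 : (0 : ℝ) < (s : ℝ) + 1 := by positivity
      have h3 : (0 : ℝ) < θ ^ a (t + 1) := by positivity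
      field_simp
  rw [hfcost] at hfade
  -- the stage cost, explicitly (verbatim (E35b))
  have hcost : ∑ t ∈ range (s + 1), ε t * L t = (1 + (1 / γ ^ 2 + (b + c) * (k s + 2))) ^ 3 *
      (c * θ ^ (a 0 - 1) / (s + 1) / b + ∑ t ∈ range s, θ ^ (a (t + 1) - 1) / θ ^ (a t - 1)) := by
    rw [sum_range_succ', hL, hη0, mul_add, mul_sum, add_comm]
    congr 1
    · rw [hε, hT, hx]; ring
    · refine sum_congr rfl fun t _ => ?_
      rw [hL, hηs, hT, hx, hε, hε]
      have h1 : (0 : ℝ) < θ ^ (a t - 1) := by positivity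
      have h2 : (0 : ℝ) < (s : ℝ) + 1 := by positivity
      field_simp
  refine ⟨β, Λ, gA, gB,
    rgEqH_A hc hθ0 hθ1 hγ hb hε hS hB hx hY rfl hW hT hη0 hηs hL hgA hgB hβ ha0 hak hks hka hεb',
    rgEqH_B hc hθ0 hθ1 hγ hb hε hS hB hx hY rfl hW hT hη0 hηs hL hgB hβ hks hka hεb',
    hAbox, hBbox, hpin, scaleShiftRate (γ := γ) hc hθ0 hb hε hη0 hηs hL hYtop hβ, hHL, hΛ0,
    fun kk => (hrows kk).trans (le_of_eq hcost), hfade, hsign, hfloor, ?_⟩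
  rw [← hε]
  exact eps_le_disc hc hθ0 hθ1 hγ hb hε hS hB hx hY rfl hW hT hgA hgB hks

/-- **NO RATIO UNIFORM IN THE FADING CONSTANT (E36c).**  For ALL class constants — NE4's `c > 0` and `0 < θ < 1`, the box `γ > 0`, the
floor `b > 0`, ANY row budget `M > 0` — and for EVERY `C′` and `κ < 1`, there are a history family `β`, moduli `Λ` WITH `FadingMemory C_Λ θ Λ`
FOR SOME CONSTANT `C_Λ`, a cutoff `K`, two pinned runs `gA` (K steps) ∕ `gB` (K + 1 steps) of (0.20) in ]0,γ] and `j ≤ K` satisfying every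
binder of (E33g)∕(E36b) — `ScaleShiftRate c θ γ β`, `HistLipschitz Λ γ β`, `Λ ≥ 0`, rows `≤ M`, `BetaLowerH 0 γ β`, `EventualLowerH b γ 0 β`
— with `disc gA gB j > C′·κ^j`.  So in (E36b) `geometric_uniform_fading_sign` (for each fading constant `C` ONE `κ(C) < 1` over the
class) the ratio NECESSARILY depends on `C`: `κ(C) → 1` as `C → ∞`.  WITNESS: (E35c)'s staged pattern (`a_t = 2st + s + 1`,
`k_t = s·t(t+1) + (s+1)t + s`; at `j = k_s ≥ s³`, `disc = cθ^{2s²+s}∕(s+1) > C′κ^j` once `κ^s ≤ θ⁴`, `C′(s+1)θ^s < c`; rows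
`≤ (1 + 1∕γ² + 3(b+c))³(c∕b+1)(s+1)^{10}θ^s ≤ M`), whose modulus is fading by §1.  Every hypothesis shape is an UNPRINTED input of the
cell (GAPS G-t4-U2-1∕-2); nothing of [I] (1.22) is asserted; NOT B12 Thm 2, NOT BetaPertH, NOT continuum, NOT Clay.
[cite: Balaban1987RG1, (0.20) p.256 and §5 p.298] -/
theorem not_geometric_fading {c θ γ b M : ℝ} (hc : 0 < c) (hθ0 : 0 < θ) (hθ1 : θ < 1) (hγ : 0 < γ) (hb : 0 < b)
    (hM : 0 < M) (C κ : ℝ) (hκ0 : 0 ≤ κ) (hκ1 : κ < 1) :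
    ∃ (β : HBeta) (Λ : ℕ → ℕ → ℝ) (K : ℕ) (gA gB : ℕ → ℝ) (j : ℕ),
      RGEqH K β gA ∧ RGEqH (K + 1) β gB ∧
      (∀ i, i ≤ K → 0 < gA i ∧ gA i ≤ γ) ∧ (∀ i, i ≤ K + 1 → 0 < gB i ∧ gB i ≤ γ) ∧ gA K = gB (K + 1) ∧
      ScaleShiftRate c θ γ β ∧ HistLipschitz Λ γ β ∧ (∀ k i, i ≤ k → 0 ≤ Λ k i) ∧
      (∀ k, ∑ i ∈ range (k + 1), Λ k i ≤ M) ∧ (∃ CΛ : ℝ, FadingMemory CΛ θ Λ) ∧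
      BetaLowerH 0 γ β ∧ EventualLowerH b γ 0 β ∧
      j ≤ K ∧ C * κ ^ j < disc gA gB j := by
  obtain ⟨s, h1, h2, h3, h4⟩ := exists_stages (A := (1 + 1 / γ ^ 2 + 3 * (b + c)) ^ 3 * (c / b + 1)) (C := C)
    hc hθ0 hθ1 hb hM hκ0 hκ1
  -- the staged pattern (verbatim (E35c))
  obtain ⟨a, ha⟩ : ∃ a : ℕ → ℕ, ∀ t, a t = 2 * s * t + s + 1 := ⟨_, fun _ => rfl⟩
  obtain ⟨k, hk⟩ : ∃ k : ℕ → ℕ, ∀ t, k t = s * t * (t + 1) + (s + 1) * t + s := ⟨_, fun _ => rfl⟩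
  have ha0 : a 0 = k 0 + 1 := by rw [ha, hk]; ring
  have hak : ∀ t, t < s → k (t + 1) = k t + a (t + 1) := fun t _ => by rw [hk, hk, ha]; ring
  have hεb : ∀ t, t ≤ s → c * θ ^ (a t - 1) / (s + 1) ≤ b := by
    intro t _
    have hst : s ≤ a t - 1 := by rw [ha, Nat.add_sub_cancel]; exact Nat.le_add_left s _
    have hle : c * θ ^ (a t - 1) ≤ c * θ ^ s := mul_le_mul_of_nonneg_left (pow_le_pow_of_le_one hθ0.le hθ1.le hst) hc.le
    have hd : c * θ ^ (a t - 1) / (s + 1) ≤ c * θ ^ (a t - 1) :=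
      div_le_self (by positivity) (by linarith [(Nat.cast_nonneg s : (0 : ℝ) ≤ s)])
    linarith
  obtain ⟨β, Λ, gA, gB, hRA, hRB, hAbox, hBbox, hpin, hSSR, hHL, hΛ0, hrows, hfade, hsign, hfloor, hdisc⟩ :=
    witness_core_fading hc hθ0 hθ1.le hγ hb ha0 hak hεb
  refine ⟨β, Λ, k s + 1, gA, gB, k s, hRA, hRB, hAbox, hBbox, hpin, hSSR, hHL, hΛ0, fun kk => ?_, ⟨_, hfade⟩, hsign, hfloor,
    Nat.le_succ _, ?_⟩
  · exact (hrows kk).trans ((staged_cost_le hc hθ0 hθ1.le hγ hb s ha hk).trans h3)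
  · refine lt_of_lt_of_le ?_ hdisc
    have has : a s - 1 = 2 * s * s + s := by rw [ha, Nat.add_sub_cancel]
    rw [has]
    have hpos : (0 : ℝ) < c * θ ^ (2 * s * s + s) / (s + 1) := by positivity
    rcases le_or_gt C 0 with hC | hC
    · exact lt_of_le_of_lt (mul_nonpos_of_nonpos_of_nonneg hC (pow_nonneg hκ0 _)) hpos
    · have hss : s ≤ s * s := Nat.le_mul_self s
      have hks3 : s * (s * s) ≤ k s := by rw [hk]; nlinarith [Nat.zero_le s, Nat.zero_le (s * s)]
      have hexp : s + (2 * s * s + s) ≤ 4 * (s * s) := by nlinarith [hss]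
      calc C * κ ^ k s ≤ C * κ ^ (s * (s * s)) := mul_le_mul_of_nonneg_left (pow_le_pow_of_le_one hκ0 hκ1.le hks3) hC.le
        _ = C * (κ ^ s) ^ (s * s) := by rw [pow_mul]
        _ ≤ C * (θ ^ 4) ^ (s * s) := mul_le_mul_of_nonneg_left (pow_le_pow_left₀ (pow_nonneg hκ0 s) h1 _) hC.le
        _ = C * θ ^ (4 * (s * s)) := by rw [← pow_mul]
        _ ≤ C * θ ^ (s + (2 * s * s + s)) := mul_le_mul_of_nonneg_left (pow_le_pow_of_le_one hθ0.le hθ1.le hexp) hC.le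
        _ = (C * ((s : ℝ) + 1) * θ ^ s) * (θ ^ (2 * s * s + s) / ((s : ℝ) + 1)) := by
            rw [pow_add]; field_simp
        _ < c * (θ ^ (2 * s * s + s) / ((s : ℝ) + 1)) := mul_lt_mul_of_pos_right h2 (by positivity)
        _ = c * θ ^ (2 * s * s + s) / (s + 1) := by ring

/-- **THE STAGED WITNESS WITH ITS FADING CONSTANT, EXPLICITLY** (the quantitative form of §2).  For all `c θ γ b > 0` (`θ ≤ 1`) and every
number of stages `s` with `cθ^s ≤ b`, (E35c)'s staged pattern (`a_t = 2st + s + 1`, `k_t = s·t(t+1) + (s+1)t + s`, cutoff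
`K = k_s + 1 = s³ + 2s² + 2s + 1`) gives a member of the class — two pinned runs of (0.20) in ]0,γ], `ScaleShiftRate c θ γ β`,
`HistLipschitz Λ γ β`, `Λ ≥ 0`, rows `≤ (1 + 1∕γ² + 3(b+c))³(c∕b+1)(s+1)^{10}θ^s` ((E35c) `staged_cost_le`), sign, floor — whose modulus is
fading with constant AT MOST `C_s = (1 + 1∕γ² + (b+c)(s³+2s²+2s+2))³·(c∕b + s)∕θ^{2s²+s+1}` (`log C_s = (2s²+s+1)·log(1∕θ) + O(log s)`) and
whose discrepancy at `j = k_s = s³ + 2s² + 2s` is `≥ cθ^{2s²+s}∕(s+1)`. [folklore] -/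
theorem staged_witness_fading {c θ γ b : ℝ} (hc : 0 < c) (hθ0 : 0 < θ) (hθ1 : θ ≤ 1) (hγ : 0 < γ) (hb : 0 < b)
    (s : ℕ) (hsb : c * θ ^ s ≤ b) :
    ∃ (β : HBeta) (Λ : ℕ → ℕ → ℝ) (gA gB : ℕ → ℝ),
      RGEqH (s ^ 3 + 2 * s ^ 2 + 2 * s + 1) β gA ∧ RGEqH (s ^ 3 + 2 * s ^ 2 + 2 * s + 1 + 1) β gB ∧
      (∀ i, i ≤ s ^ 3 + 2 * s ^ 2 + 2 * s + 1 → 0 < gA i ∧ gA i ≤ γ) ∧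
      (∀ i, i ≤ s ^ 3 + 2 * s ^ 2 + 2 * s + 1 + 1 → 0 < gB i ∧ gB i ≤ γ) ∧
      gA (s ^ 3 + 2 * s ^ 2 + 2 * s + 1) = gB (s ^ 3 + 2 * s ^ 2 + 2 * s + 1 + 1) ∧
      ScaleShiftRate c θ γ β ∧ HistLipschitz Λ γ β ∧ (∀ k i, i ≤ k → 0 ≤ Λ k i) ∧
      (∀ k, ∑ i ∈ range (k + 1), Λ k i ≤ (1 + 1 / γ ^ 2 + 3 * (b + c)) ^ 3 * (c / b + 1) * ((s : ℝ) + 1) ^ 10 * θ ^ s) ∧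
      FadingMemory ((1 + 1 / γ ^ 2 + (b + c) * ((s : ℝ) ^ 3 + 2 * s ^ 2 + 2 * s + 2)) ^ 3 * (c / b + s) /
        θ ^ (2 * s * s + s + 1)) θ Λ ∧
      BetaLowerH 0 γ β ∧ EventualLowerH b γ 0 β ∧
      c * θ ^ (2 * s * s + s) / (s + 1) ≤ disc gA gB (s ^ 3 + 2 * s ^ 2 + 2 * s) := by
  -- the staged pattern (verbatim (E35c))
  obtain ⟨a, ha⟩ : ∃ a : ℕ → ℕ, ∀ t, a t = 2 * s * t + s + 1 := ⟨_, fun _ => rfl⟩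
  obtain ⟨k, hk⟩ : ∃ k : ℕ → ℕ, ∀ t, k t = s * t * (t + 1) + (s + 1) * t + s := ⟨_, fun _ => rfl⟩
  have ha0 : a 0 = k 0 + 1 := by rw [ha, hk]; ring
  have hak : ∀ t, t < s → k (t + 1) = k t + a (t + 1) := fun t _ => by rw [hk, hk, ha]; ring
  have hεb : ∀ t, t ≤ s → c * θ ^ (a t - 1) / (s + 1) ≤ b := by
    intro t _
    have hst : s ≤ a t - 1 := by rw [ha, Nat.add_sub_cancel]; exact Nat.le_add_left s _
    have hle : c * θ ^ (a t - 1) ≤ c * θ ^ s := mul_le_mul_of_nonneg_left (pow_le_pow_of_le_one hθ0.le hθ1 hst) hc.le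
    have hd : c * θ ^ (a t - 1) / (s + 1) ≤ c * θ ^ (a t - 1) :=
      div_le_self (by positivity) (by linarith [(Nat.cast_nonneg s : (0 : ℝ) ≤ s)])
    linarith
  obtain ⟨β, Λ, gA, gB, hRA, hRB, hAbox, hBbox, hpin, hSSR, hHL, hΛ0, hrows, hfade, hsign, hfloor, hdisc⟩ :=
    witness_core_fading hc hθ0 hθ1 hγ hb ha0 hak hεb
  have hks : k s = s ^ 3 + 2 * s ^ 2 + 2 * s := by rw [hk]; ring
  have has : a s - 1 = 2 * s * s + s := by rw [ha, Nat.add_sub_cancel]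
  rw [hks] at hRA hRB hAbox hBbox hpin hdisc
  rw [has] at hdisc
  refine ⟨β, Λ, gA, gB, hRA, hRB, hAbox, hBbox, hpin, hSSR, hHL, hΛ0,
    fun kk => (hrows kk).trans (staged_cost_le hc hθ0 hθ1 hγ hb s ha hk),
    fun kk i hik => ⟨(hfade kk i hik).1, (hfade kk i hik).2.trans (mul_le_mul_of_nonneg_right ?_ (pow_nonneg hθ0.le _))⟩,
    hsign, hfloor, hdisc⟩
  -- the raw fading constant is at most C_s (monotonicity of `FadingMemory` in the amplitude, inline)
  have hθle : ∀ n m : ℕ, n ≤ m → (θ ^ m)⁻¹ ≥ (θ ^ n)⁻¹ := fun n m hnm => by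
    rw [ge_iff_le, inv_le_inv₀ (pow_pos hθ0 _) (pow_pos hθ0 _)]
    exact pow_le_pow_of_le_one hθ0.le hθ1 hnm
  have hP : (0 : ℝ) ≤ (1 + (1 / γ ^ 2 + (b + c) * (k s + 2))) ^ 3 := by positivity
  have hPe : (1 + (1 / γ ^ 2 + (b + c) * ((k s : ℝ) + 2))) ^ 3
      = (1 + 1 / γ ^ 2 + (b + c) * ((s : ℝ) ^ 3 + 2 * s ^ 2 + 2 * s + 2)) ^ 3 := by
    rw [hks]; push_cast; ring
  -- term 0: cθ^{a0−1}∕((s+1) b θ^{a0}) ≤ (c∕b)∕θ^{2s²+s+1}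
  have h0 : c * θ ^ (a 0 - 1) / (s + 1) / b / θ ^ a 0 ≤ c / b / θ ^ (2 * s * s + s + 1) := by
    have ha0' : a 0 = s + 1 := by rw [ha]; ring
    rw [ha0', Nat.add_sub_cancel]
    have e : c * θ ^ s / (s + 1) / b / θ ^ (s + 1) = c / b / θ / ((s : ℝ) + 1) := by
      rw [pow_succ]; field_simp
    rw [e]
    have h1 : c / b / θ / ((s : ℝ) + 1) ≤ c / b / θ := div_le_self (by positivity) (by linarith [(Nat.cast_nonneg s : (0 : ℝ) ≤ s)])
    refine h1.trans ?_
    rw [div_eq_mul_inv (c / b) θ, div_eq_mul_inv (c / b)]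
    refine mul_le_mul_of_nonneg_left ?_ (by positivity)
    have := hθle 1 (2 * s * s + s + 1) (by omega)
    rwa [pow_one] at this
  -- terms t < s: θ^{a_{t+1}−1}∕(θ^{a_t−1} θ^{a_{t+1}}) = 1∕θ^{a_t} ≤ 1∕θ^{2s²+s+1}
  have ht : ∀ t ∈ range s, θ ^ (a (t + 1) - 1) / θ ^ (a t - 1) / θ ^ a (t + 1) ≤ 1 / θ ^ (2 * s * s + s + 1) := by
    intro t htm
    have hts : t < s := mem_range.mp htm
    have e : θ ^ (a (t + 1) - 1) / θ ^ (a t - 1) / θ ^ a (t + 1) = (θ ^ a t)⁻¹ := by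
      have h1 : a (t + 1) = (a (t + 1) - 1) + 1 := by rw [ha]; omega
      have h2 : a t = (a t - 1) + 1 := by rw [ha]; omega
      rw [h2, h1, Nat.add_sub_cancel, Nat.add_sub_cancel, pow_succ, pow_succ]
      field_simp
    rw [e, one_div]
    refine (hθle (a t) (2 * s * s + s + 1) ?_).le
    rw [ha]; nlinarith
  calc (1 + (1 / γ ^ 2 + (b + c) * ((k s : ℝ) + 2))) ^ 3 *
        (c * θ ^ (a 0 - 1) / (s + 1) / b / θ ^ a 0 + ∑ t ∈ range s, θ ^ (a (t + 1) - 1) / θ ^ (a t - 1) / θ ^ a (t + 1))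
      ≤ (1 + (1 / γ ^ 2 + (b + c) * ((k s : ℝ) + 2))) ^ 3 *
        (c / b / θ ^ (2 * s * s + s + 1) + ∑ _t ∈ range s, 1 / θ ^ (2 * s * s + s + 1)) :=
        mul_le_mul_of_nonneg_left (add_le_add h0 (sum_le_sum ht)) hP
    _ = (1 + 1 / γ ^ 2 + (b + c) * ((s : ℝ) ^ 3 + 2 * s ^ 2 + 2 * s + 2)) ^ 3 * (c / b + s) / θ ^ (2 * s * s + s + 1) := by
        rw [sum_const, card_range, nsmul_eq_mul, hPe]
        field_simp

/-- **THE RATIO IS NOT UNIFORM IN THE FADING CONSTANT — QUANTITATIVELY.**  If a ratio `κ ≥ 0` and a constant `D` serve the class with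
fading constant `C_s = (1 + 1∕γ² + (b+c)(s³+2s²+2s+2))³(c∕b+s)∕θ^{2s²+s+1}` and row budget `(1 + 1∕γ² + 3(b+c))³(c∕b+1)(s+1)^{10}θ^s` — i.e.
`disc gA gB j ≤ D·κ^j` for every member with these binders, every cutoff and `j ≤ K` — then `cθ^{2s²+s}∕(s+1) ≤ D·κ^{s³+2s²+2s}`.  Read
with (E36b)'s `D = 2c∕(1−θ)`: `κ(C_s)^{s³+2s²+2s} ≥ (1−θ)θ^{2s²+s}∕(2(s+1))`, so `log(1∕κ(C_s)) ≲ 2·log(1∕θ)∕s ≍ (log(1∕θ))^{3∕2}∕√(log C_s)`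
against (E36b)'s `log(1∕κ) ≳ log(1∕θ)·log(1∕(4MU))∕log(C∕M)`: the ratio tends to `1` as the fading constant grows, between these two
rates. [folklore] -/
theorem ratio_lower_bound {c θ γ b κ D : ℝ} (hc : 0 < c) (hθ0 : 0 < θ) (hθ1 : θ ≤ 1) (hγ : 0 < γ) (hb : 0 < b)
    (s : ℕ) (hsb : c * θ ^ s ≤ b)
    (hserve : ∀ (β : HBeta) (Λ : ℕ → ℕ → ℝ) (K : ℕ) (gA gB : ℕ → ℝ),
      RGEqH K β gA → RGEqH (K + 1) β gB →
      (∀ i, i ≤ K → 0 < gA i ∧ gA i ≤ γ) → (∀ i, i ≤ K + 1 → 0 < gB i ∧ gB i ≤ γ) → gA K = gB (K + 1) →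
      ScaleShiftRate c θ γ β → HistLipschitz Λ γ β →
      FadingMemory ((1 + 1 / γ ^ 2 + (b + c) * ((s : ℝ) ^ 3 + 2 * s ^ 2 + 2 * s + 2)) ^ 3 * (c / b + s) /
        θ ^ (2 * s * s + s + 1)) θ Λ →
      (∀ k, ∑ i ∈ range (k + 1), Λ k i ≤ (1 + 1 / γ ^ 2 + 3 * (b + c)) ^ 3 * (c / b + 1) * ((s : ℝ) + 1) ^ 10 * θ ^ s) →
      BetaLowerH 0 γ β → EventualLowerH b γ 0 β →
      ∀ j, j ≤ K → disc gA gB j ≤ D * κ ^ j) :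
    c * θ ^ (2 * s * s + s) / (s + 1) ≤ D * κ ^ (s ^ 3 + 2 * s ^ 2 + 2 * s) := by
  obtain ⟨β, Λ, gA, gB, hRA, hRB, hAbox, hBbox, hpin, hSSR, hHL, _, hrows, hfade, hsign, hfloor, hdisc⟩ :=
    staged_witness_fading hc hθ0 hθ1 hγ hb s hsb
  exact hdisc.trans (hserve β Λ _ gA gB hRA hRB hAbox hBbox hpin hSSR hHL hfade hrows hsign hfloor _ (Nat.le_succ _))

/-! ## §3 The dichotomy of the rate row (by name) -/

/-- **THE DICHOTOMY OF THE RATE ROW — GEOMETRIC IFF THE FADING CONSTANT IS BOUNDED OVER THE CLASS (sandwich, by name).**  For all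
`c > 0`, `0 < θ < 1`, box `γ > 0`, floor `b > 0` and row budget `M > 0` with the ROW smallness `4·M·(γ³ + 2γ∕b) < 1` (floor from scale 0),
consider the class of (E33g)∕(E35c): two pinned runs of (0.20) in ]0,γ], `ScaleShiftRate c θ γ β`, `HistLipschitz Λ γ β`, `Λ ≥ 0`, rows
`≤ M`, sign, floor.  THEN (i) ((E36b) `geometric_uniform_fading_sign`) for EVERY fading constant `C ≥ 0` there is ONE `κ`, `θ < κ < 1`,
with `disc gA gB j ≤ (2c∕(1−θ))·κ^j` for every member with `FadingMemory C θ Λ`, every cutoff and every `j ≤ K`; (ii) (§2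
`not_geometric_fading`) for EVERY `κ < 1` and `C′` some member WITH a fading modulus (some constant) and some `j ≤ K` have
`disc gA gB j > C′·κ^j`.  Geometric for each fading constant, with node U2's constant and no smallness on it; not geometric uniformly in
the fading constant — at the β level. [cite: Balaban1987RG1, (0.20) p.256 and §5 p.298] -/
theorem fading_dichotomy {c θ γ b M : ℝ} (hc : 0 < c) (hθ0 : 0 < θ) (hθ1 : θ < 1) (hγ : 0 < γ) (hb : 0 < b) (hM : 0 < M)
    (hsmall : 4 * (M * ((((0 : ℕ) : ℝ) + 1) * γ ^ 3 + 2 * γ / b)) < 1) :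
    (∀ C : ℝ, 0 ≤ C → ∃ κ : ℝ, θ < κ ∧ κ < 1 ∧ ∀ (β : HBeta) (Λ : ℕ → ℕ → ℝ) (K : ℕ) (gA gB : ℕ → ℝ),
        RGEqH K β gA → RGEqH (K + 1) β gB →
        (∀ i, i ≤ K → 0 < gA i ∧ gA i ≤ γ) → (∀ i, i ≤ K + 1 → 0 < gB i ∧ gB i ≤ γ) → gA K = gB (K + 1) →
        ScaleShiftRate c θ γ β → HistLipschitz Λ γ β → FadingMemory C θ Λ →
        (∀ k, ∑ i ∈ range (k + 1), Λ k i ≤ M) → BetaLowerH 0 γ β → EventualLowerH b γ 0 β →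
        ∀ j, j ≤ K → disc gA gB j ≤ 2 * c / (1 - θ) * κ ^ j) ∧
    (∀ C κ : ℝ, 0 ≤ κ → κ < 1 → ∃ (β : HBeta) (Λ : ℕ → ℕ → ℝ) (K : ℕ) (gA gB : ℕ → ℝ) (j : ℕ),
        RGEqH K β gA ∧ RGEqH (K + 1) β gB ∧
        (∀ i, i ≤ K → 0 < gA i ∧ gA i ≤ γ) ∧ (∀ i, i ≤ K + 1 → 0 < gB i ∧ gB i ≤ γ) ∧ gA K = gB (K + 1) ∧
        ScaleShiftRate c θ γ β ∧ HistLipschitz Λ γ β ∧ (∀ k i, i ≤ k → 0 ≤ Λ k i) ∧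
        (∀ k, ∑ i ∈ range (k + 1), Λ k i ≤ M) ∧ (∃ CΛ : ℝ, FadingMemory CΛ θ Λ) ∧
        BetaLowerH 0 γ β ∧ EventualLowerH b γ 0 β ∧
        j ≤ K ∧ C * κ ^ j < disc gA gB j) :=
  ⟨fun _ hC => geometric_uniform_fading_sign (k₀ := 0) hc.le hθ0.le hθ1 hγ hb hC hM hsmall,
    fun C κ hκ0 hκ1 => not_geometric_fading hc hθ0 hθ1 hγ hb hM C κ hκ0 hκ1⟩

end Summit.QuantumFields.BalabanUV.Beta.EriceRemainderEnclosureHistoryFadingWitness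

end
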